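import Mathlib
import HarnessLib
import Literature.AlgebraicGeometry.Resolution.RegularCentreRsopPart
import Literature.AlgebraicGeometry.Resolution.BlowupsEquivariant
import Summits.ResolutionOfSingularities.ResolutionOfSingularities.Theorems.WildQuotientsWildQuotientResolutionKSCentreStepRsopPart

/-!
# Kollár–Szabó going down: blowing up a REGULAR G-STABLE CLOSED SUBSCHEME through a fixed point keeps a fixed point
# (scheme-level form; crux `WildQuotients.WildQuotientResolution`, stub `stub_phaseZeroHighDim`)

Crux stmt-ResolutionOfSingularities-15640 (`WildQuotientResolution`), registered stub `stub_phaseZeroHighDim`;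
programme PHASE0-KS-EIGENLINE, item (K2-centres) — the form the Phase-0 game consumes. Hand 8-g3's step theorems
(✓`exists_fixedPoint_liftAction_step_of_isRsopPart(_of_normal_isPGroup)`, p831665) take the centre through its stalk
`I_x = (z)` with `z` part of a regular system of parameters; the tree's ✓`exists_isRsopPart_span_range_eq_stalkIdeal_of_mem_closeds`
(`RegularCentreRsopPart.lean`, Matsumura 14.2) supplies exactly that for a REGULAR closed subscheme `Y ∋ x` (reduced
structure `vanishingIdeal Y`), and ✓`vanishingIdeal_comap_eq_of_action` turns set-theoretic `G`-stability of `Y` into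
stability of its ideal sheaf:

* ★ `exists_fixedPoint_liftAction_step_of_regular_closeds` (ABELIAN `G`) and
  ★ `exists_fixedPoint_liftAction_step_of_regular_closeds_of_normal_isPGroup` (`G ⊵ P ⊇ [G,G]`, `char κ = p`) —
  **X integral locally Noetherian, `g ∈ I_x` for all `g ∈ G` at a CLOSED point `x` with `𝒪_{X,x}` regular and `κ(x)`
  algebraically closed, `Y ⊆ X` a `G`-stable closed subset through `x` whose reduced subscheme is REGULAR, with
  `𝓘_{Y,x} ≠ 0` and `𝓘_Y ≠ 0`, `π : X' → X` ANY blowing up along `𝓘_Y` with the LIFTED action ⇒ `X'` integral and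
  locally Noetherian, and a CLOSED `x' ∈ X'` over `x` with `g ∈ I_{x'}` for every `g`, `𝒪_{X',x'}` regular of the same
  dimension, `κ(x')` algebraically closed.** Blow-ups of regular stable centres never shrink such inertia.

[OURS · crux stmt-ResolutionOfSingularities-15640 · helper toward `stub_phaseZeroHighDim` ((K2-centres), closed-subscheme
form; NOT a proof of the stub); counted 0; AI-level work, weaker than expert review.]
[cite: ReichsteinYoussin2000, Appendix (Kollár–Szabó), Lemma A.1 and proof of Prop. A.2] [cite: Matsumura1987, Thm. 14.2]
-/

-- single-problem summit: the doubled namespace component `ResolutionOfSingularities` is forced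
set_option linter.dupNamespace false

noncomputable section

open CategoryTheory CategoryTheory.Limits AlgebraicGeometry TopologicalSpace IsLocalRing
open Literature.AlgebraicGeometry.Ramification Literature.AlgebraicGeometry.Resolution
open Scheme.IdealSheafData
open Summit.ResolutionOfSingularities.ResolutionOfSingularities.Theorems.WildQuotientResolution

namespace Summit.ResolutionOfSingularities.ResolutionOfSingularities.Theorems.WildQuotientResolution.CentreChart

/-- **Blowing up a regular `G`-stable closed subscheme through a point fixed by an ABELIAN `G` keeps a fixed point with
all hypotheses reproduced** (Kollár–Szabó going down along regular centres, scheme-level form).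
[cite: ReichsteinYoussin2000, Appendix (Kollár–Szabó), proof of Prop. A.2] [cite: Matsumura1987, Thm. 14.2] -/
theorem exists_fixedPoint_liftAction_step_of_regular_closeds {X : Scheme.{0}} [IsIntegral X]
    [IsLocallyNoetherian X] {G : Type} [CommGroup G] (σ : G →* Aut X) {x : X} (hxc : IsClosed ({x} : Set X))
    (hGx : ∀ g, g ∈ inertiaSubgroup σ x)
    [IsRegularLocalRing (X.presheaf.stalk x)] [IsAlgClosed (ResidueField (X.presheaf.stalk x))]
    {Y : Closeds X} (hY : ∀ g, (σ g).hom.base ⁻¹' (Y : Set X) = Y)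
    (hreg : Scheme.IsRegular (vanishingIdeal Y).subscheme) (hxY : x ∈ (Y : Set X))
    (hIx0 : stalkIdeal (vanishingIdeal Y) x ≠ ⊥) (hI0 : vanishingIdeal Y ≠ ⊥)
    {X' : Scheme.{0}} {π : X' ⟶ X} (hπ : IsBlowup π (vanishingIdeal Y)) :
    IsIntegral X' ∧ IsLocallyNoetherian X' ∧
    ∃ x' : X', π x' = x ∧ IsClosed ({x'} : Set X') ∧
      (∀ g, g ∈ inertiaSubgroup (hπ.liftAction σ (vanishingIdeal_comap_eq_of_action σ Y hY)) x') ∧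
      IsRegularLocalRing (X'.presheaf.stalk x') ∧ IsAlgClosed (ResidueField (X'.presheaf.stalk x')) ∧
      ringKrullDim (X'.presheaf.stalk x') = ringKrullDim (X.presheaf.stalk x) := by
  obtain ⟨r, c, hc, hspan⟩ := exists_isRsopPart_span_range_eq_stalkIdeal_of_mem_closeds hreg hxY
  exact exists_fixedPoint_liftAction_step_of_isRsopPart σ hxc hGx (vanishingIdeal_comap_eq_of_action σ Y hY) c hc
    hspan.symm hIx0 hI0 hπ

/-- **Blowing up a regular `G`-stable closed subscheme through a point fixed by a p-CLOSED `G ⊵ P ⊇ [G,G]` keeps a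
fixed point with all hypotheses reproduced.**
[cite: ReichsteinYoussin2000, Appendix (Kollár–Szabó), Lemma A.1 and proof of Prop. A.2] [cite: Matsumura1987, Thm. 14.2] -/
theorem exists_fixedPoint_liftAction_step_of_regular_closeds_of_normal_isPGroup {X : Scheme.{0}} [IsIntegral X]
    [IsLocallyNoetherian X] {G : Type} [Group G] [Finite G] {p : ℕ} [Fact p.Prime]
    (P : Subgroup G) [P.Normal] (hP : IsPGroup p P) (hcomm : ∀ g h : G, g * h * g⁻¹ * h⁻¹ ∈ P)
    (σ : G →* Aut X) {x : X} (hxc : IsClosed ({x} : Set X))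
    (hGx : ∀ g, g ∈ inertiaSubgroup σ x)
    [IsRegularLocalRing (X.presheaf.stalk x)] [CharP (ResidueField (X.presheaf.stalk x)) p]
    [IsAlgClosed (ResidueField (X.presheaf.stalk x))]
    {Y : Closeds X} (hY : ∀ g, (σ g).hom.base ⁻¹' (Y : Set X) = Y)
    (hreg : Scheme.IsRegular (vanishingIdeal Y).subscheme) (hxY : x ∈ (Y : Set X))
    (hIx0 : stalkIdeal (vanishingIdeal Y) x ≠ ⊥) (hI0 : vanishingIdeal Y ≠ ⊥)
    {X' : Scheme.{0}} {π : X' ⟶ X} (hπ : IsBlowup π (vanishingIdeal Y)) :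
    IsIntegral X' ∧ IsLocallyNoetherian X' ∧
    ∃ x' : X', π x' = x ∧ IsClosed ({x'} : Set X') ∧
      (∀ g, g ∈ inertiaSubgroup (hπ.liftAction σ (vanishingIdeal_comap_eq_of_action σ Y hY)) x') ∧
      IsRegularLocalRing (X'.presheaf.stalk x') ∧ IsAlgClosed (ResidueField (X'.presheaf.stalk x')) ∧
      ringKrullDim (X'.presheaf.stalk x') = ringKrullDim (X.presheaf.stalk x) := by
  obtain ⟨r, c, hc, hspan⟩ := exists_isRsopPart_span_range_eq_stalkIdeal_of_mem_closeds hreg hxY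
  exact exists_fixedPoint_liftAction_step_of_isRsopPart_of_normal_isPGroup P hP hcomm σ hxc hGx
    (vanishingIdeal_comap_eq_of_action σ Y hY) c hc hspan.symm hIx0 hI0 hπ

end Summit.ResolutionOfSingularities.ResolutionOfSingularities.Theorems.WildQuotientResolution.CentreChart

end
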